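import Literature.MathematicalPhysics.QuantumLattice.GrassmannEffectiveActionLipschitzDB
import Literature.MathematicalPhysics.QuantumLattice.GrassmannZoneTruncatedBoundDB
import Literature.MathematicalPhysics.QuantumLattice.GrassmannWeightedCumulantBound
import HarnessLib

/-!
# The POLARISED cumulant bound with a ZONE: an interaction defect supported near a boundary is suppressed at deep pins
# (determinant-bounded covariances, tree-weighted norms)

Topic `MathematicalPhysics/QuantumLattice`; continuation of `GrassmannEffectiveActionLipschitzDB` (polarised cumulant bound, homogeneous in the pin) and
`GrassmannZoneTruncatedBoundDB` (truncated expectation against an admissible constant).  For two species of even vertices `X₀`, `X₁` where every kernel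
of `X₁` is supported on label families TOUCHING A ZONE `Z`, and an output pin `w` such that a constant `Λ` satisfies `Λ ≤ wt S` for every label set
`S ∋ w` meeting `Z` (e.g. `wt = 1 + diam`, `dist(w, Z) ≥ R`, `Λ = 1 + R`), the difference of cumulants `𝓔ᵀ_C(X₀+X₁; n) − 𝓔ᵀ_C(X₀; n)` — the sum over
the species assignments with at least one `X₁` copy — obeys the polarised bound of BGM 2006 (2.13)–(2.14)/(2.77)–(2.80) with `wt`-weighted norms AND the
extra factor `Λ⁻¹`: in every such assignment the anchored tree joins the pinned output `w` to the `X₁` copy, whose labels meet `Z`, so the hull weight is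
`≥ Λ` (`const_mul_sum_norm_kernel_ursellOf_kernelVertex_le_of_gramBounded`).  This is the cumulant layer of the inhomogeneous Lipschitz continuity of
`V ↦ effAction C V` used when two volumes' effective actions are compared box by box (the defect lives at the box boundaries, the comparison is read
at deep pins).

* **`const_mul_sum_norm_kernel_cumulantOf_add_sub_le_of_gramBounded`** —
  `Λ · Σ_{W : W_i = w} ‖kernel_r (𝓔ᵀ_C(X₀+X₁; n) − 𝓔ᵀ_C(X₀; n)) (W)‖ ≤ n!·ρ^{-r}κ^{-2(n−1)}α^{n−1}eⁿ·((A₀ + A₁)ⁿ − A₀ⁿ)`, `A_s = Σ_{m'} (e²(κ+ρ))^{2m'} N_s(m')`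
  with `wt`-weighted anchored norms `N_s` and `wt`-weighted row/column sums `α`.

Everything is proved; no definition, no named fact.

## Sources
G. Benfatto, A. Giuliani, V. Mastropietro, Ann. Henri Poincaré 7 (2006) 809–898, (2.13)–(2.14), (2.77)–(2.80), (2.86)–(2.90)
[`BenfattoGiulianiMastropietro2006`]; K. Gawȩdzki, A. Kupiainen, Comm. Math. Phys. 102 (1985) 1–30, §3 [`GawedzkiKupiainen1985GrossNeveu`].
-/

noncomputable section

namespace Literature.MathematicalPhysics.QuantumLattice

open GrassmannAlgebra Finset Literature.Probability.LatticeModels Literature.Probability.LatticeModels.BattleFederbush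
open scoped InnerProductSpace Nat

universe u

variable {𝕜 : Type*} [RCLike 𝕜] {Γ : Type u} [Fintype Γ] [DecidableEq Γ] {n : ℕ} {wt : Finset Γ → ℝ} (C : Matrix Γ Γ 𝕜)

/-! ### Elementary inequalities -/

section Elementary

/-- `(a+b)ⁿ − aⁿ ≤ n·b·(a+b)^{n−1}` for `0 ≤ a, b`. [folklore] -/
private theorem add_pow_sub_pow_le' {a b : ℝ} (ha : 0 ≤ a) (hb : 0 ≤ b) (n : ℕ) :
    (a + b) ^ n - a ^ n ≤ (n : ℝ) * b * (a + b) ^ (n - 1) := by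
  have hgeom := geom_sum₂_mul (a + b) a n
  rw [add_sub_cancel_left] at hgeom
  rw [← hgeom]
  have hterm : ∀ i ∈ range n, (a + b) ^ i * a ^ (n - 1 - i) ≤ (a + b) ^ (n - 1) := by
    intro i hi
    have hi' : i ≤ n - 1 := by have := mem_range.1 hi; omega
    calc (a + b) ^ i * a ^ (n - 1 - i) ≤ (a + b) ^ i * (a + b) ^ (n - 1 - i) :=
          mul_le_mul_of_nonneg_left (pow_le_pow_left₀ ha (le_add_of_nonneg_right hb) _) (by positivity)
      _ = (a + b) ^ (n - 1) := by rw [← pow_add]; congr 1; omega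
  calc (∑ i ∈ range n, (a + b) ^ i * a ^ (n - 1 - i)) * b ≤ (∑ _i ∈ range n, (a + b) ^ (n - 1)) * b :=
        mul_le_mul_of_nonneg_right (sum_le_sum hterm) hb
    _ = (n : ℝ) * b * (a + b) ^ (n - 1) := by rw [sum_const, card_range, nsmul_eq_mul]; ring

/-- `Σ_{n < n₀} (n+1) θⁿ ≤ (1−θ)^{-2}` for `0 ≤ θ < 1`. [folklore] -/
private theorem sum_range_succ_mul_pow_le' {θ : ℝ} (hθ0 : 0 ≤ θ) (hθ1 : θ < 1) (n₀ : ℕ) :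
    ∑ k ∈ range n₀, ((k : ℝ) + 1) * θ ^ k ≤ 1 / (1 - θ) ^ 2 := by
  have hnorm : ‖θ‖ < 1 := by rw [Real.norm_eq_abs, abs_of_nonneg hθ0]; exact hθ1
  have h1 : HasSum (fun k : ℕ => (k : ℝ) * θ ^ k) (θ / (1 - θ) ^ 2) := hasSum_coe_mul_geometric_of_norm_lt_one hnorm
  have h2 : HasSum (fun k : ℕ => θ ^ k) (1 - θ)⁻¹ := hasSum_geometric_of_lt_one hθ0 hθ1
  have h3 : HasSum (fun k : ℕ => ((k : ℝ) + 1) * θ ^ k) (θ / (1 - θ) ^ 2 + (1 - θ)⁻¹) := by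
    have := h1.add h2
    refine this.congr_fun fun k => ?_
    ring
  have hsum : θ / (1 - θ) ^ 2 + (1 - θ)⁻¹ = 1 / (1 - θ) ^ 2 := by
    have h1θ : (1 - θ) ≠ 0 := by linarith
    field_simp
    ring
  rw [← hsum]
  exact sum_le_hasSum (range n₀) (fun k _ => by positivity) h3

end Elementary

/-! ### The polarised cumulant bound -/

section Polarised



/-- The species-and-degree assignments whose species are all `0` are the degree assignments tagged with `0`. [folklore] -/
private theorem filter_piFinset_fst_eq_zero_eq_map (degs : Finset ℕ) :
    (Fintype.piFinset (fun _ : Fin n => (univ : Finset (Fin 2)) ×ˢ degs)).filter (fun η => ∀ a, (η a).1 = 0) =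
      (Fintype.piFinset (fun _ : Fin n => degs)).map
        ⟨fun δ a => ((0 : Fin 2), δ a), fun _ _ h => funext fun a => congrArg Prod.snd (congrFun h a)⟩ := by
  ext η
  simp only [mem_filter, Fintype.mem_piFinset, mem_product, mem_univ, true_and, mem_map, Function.Embedding.coeFn_mk]
  constructor
  · rintro ⟨hdeg, hsp⟩
    exact ⟨fun a => (η a).2, hdeg, funext fun a => Prod.ext (hsp a).symm rfl⟩
  · rintro ⟨δ, hδ, rfl⟩
    exact ⟨hδ, fun a => rfl⟩

/-- **The POLARISED cumulant bound AGAINST AN ADMISSIBLE CONSTANT (interaction defect touching a zone, output pinned far from it)**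
(BGM 2006 (2.13)–(2.14) with (2.77)–(2.80), two species of vertices, tree-weighted norms): as `sum_norm_kernel_cumulantOf_add_sub_le_of_gramBounded` with
`wt`-weighted anchored norms `N_s` and `wt`-weighted row/column sums `α`, every kernel of the species-`1` element supported on label families touching `Z`,
and a constant `Λ ≥ 0` with `Λ ≤ wt S` for every label set `S ∋ w` meeting `Z`:
`Λ · Σ_{W : W_i = w} ‖kernel_r (𝓔ᵀ_C(X₀+X₁; n) − 𝓔ᵀ_C(X₀; n)) (W)‖ ≤ n!·ρ^{-r}κ^{-2(n−1)}α^{n−1}eⁿ·((A₀ + A₁)ⁿ − A₀ⁿ)` — every assignment with a species-`1` copy has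
a hull containing `w` and a point of `Z` (`const_mul_sum_norm_kernel_ursellOf_kernelVertex_le_of_gramBounded`).
[cite: BenfattoGiulianiMastropietro2006, (2.13)-(2.14) and (2.77)-(2.80)] -/
theorem const_mul_sum_norm_kernel_cumulantOf_add_sub_le_of_gramBounded (hwt : IsTreeWeight wt) {κ : ℝ} (hκ : 0 < κ)
    (hGB : IsGramBoundedR C κ)
    (degs : Finset ℕ) (Ksp : Fin 2 → (m' : ℕ) → (Fin (2 * m') → Γ) → 𝕜) (Nsp : Fin 2 → ℕ → ℝ) (hN0 : ∀ s m', 0 ≤ Nsp s m')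
    (hN : ∀ s m' (j : Fin (2 * m')) (w : Γ), ∑ Y ∈ univ.filter (fun Y : Fin (2 * m') → Γ => Y j = w), ‖Ksp s m' Y‖ * wt (univ.image Y) ≤ Nsp s m')
    {α : ℝ} (hα : 0 < α) (hrow : ∀ X, ∑ Y, ‖C X Y‖ * wt {X, Y} ≤ α) (hcol : ∀ Y, ∑ X, ‖C X Y‖ * wt {X, Y} ≤ α) {ρ : ℝ} (hρ : 0 < ρ)
    (hn : 0 < n) {r : ℕ} (i : Fin r) (w : Γ) (Z : Set Γ) (hZ : ∀ (s : Fin 2), s ≠ 0 → ∀ (m' : ℕ) (Y : Fin (2 * m') → Γ), Ksp s m' Y ≠ 0 → ∃ j, Y j ∈ Z)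
    {Λ : ℝ} (hΛ0 : 0 ≤ Λ) (hΛ : ∀ S : Finset Γ, w ∈ S → (∃ z ∈ S, z ∈ Z) → Λ ≤ wt S) :
    Λ * ∑ W ∈ univ.filter (fun W : Fin r → Γ => W i = w),
        ‖kernel 𝕜 ((cumulantOf (fun k => evenGaussConv 𝕜 C ((vertexOf 𝕜 degs (Ksp 0) + vertexOf 𝕜 degs (Ksp 1)) ^ k)) n :
            evenPart 𝕜 Γ) : GrassmannAlgebra 𝕜 Γ) r W -
          kernel 𝕜 ((cumulantOf (fun k => evenGaussConv 𝕜 C (vertexOf 𝕜 degs (Ksp 0) ^ k)) n : evenPart 𝕜 Γ) :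
            GrassmannAlgebra 𝕜 Γ) r W‖ ≤
      (n.factorial : ℝ) * (ρ⁻¹ ^ r * κ⁻¹ ^ (2 * (n - 1)) * (α ^ (n - 1) * Real.exp n)) *
        ((∑ m' ∈ degs, (Real.exp 2 * (κ + ρ)) ^ (2 * m') * Nsp 0 m' + ∑ m' ∈ degs, (Real.exp 2 * (κ + ρ)) ^ (2 * m') * Nsp 1 m') ^ n -
          (∑ m' ∈ degs, (Real.exp 2 * (κ + ρ)) ^ (2 * m') * Nsp 0 m') ^ n) := by
  set C' : Matrix (Fin n × Γ) (Fin n × Γ) 𝕜 := C.submatrix Prod.snd Prod.snd with hC'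
  have huniv : (univ : Finset (Fin n)).Nonempty := ⟨⟨0, hn⟩, mem_univ _⟩
  have hGB' : IsGramBounded C' κ := by rw [hC']; exact (hGB.submatrix Prod.snd).isGramBounded
  -- the species-and-degree replica families
  set U : (Fin n → Fin 2 × ℕ) → evenPart 𝕜 (Fin n × Γ) := fun η => ursellOf (convMoment 𝕜 C'
    (kernelVertex 𝕜 (deg := fun b : Fin n => 2 * (η b).2) (fun b => even_two_mul (η b).2)
      fun b => replicaKer 𝕜 (Ksp (η b).1 (η b).2) b)) univ with hU
  set M' : Fin n → Fin 2 × ℕ → evenPart 𝕜 (Fin n × Γ) := fun a sm =>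
    kernelVertex 𝕜 (deg := fun _ : Fin n => 2 * sm.2) (fun _ => even_two_mul sm.2) (fun b => replicaKer 𝕜 (Ksp sm.1 sm.2) b) a with hM'
  have hM'mem : ∀ a sm, (M' a sm : GrassmannAlgebra 𝕜 (Fin n × Γ)) ∈ fieldSubalgebra 𝕜 ((Prod.fst : Fin n × Γ → Fin n) ⁻¹' {a}) :=
    fun a sm => coe_kernelVertex_replicaKer_mem 𝕜 sm.2 (Ksp sm.1 sm.2) a
  set T : Finset (Fin 2 × ℕ) := (univ : Finset (Fin 2)) ×ˢ degs with hT
  -- (1) the full family collapses to `X₀ + X₁`, and expands over all assignments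
  have hcollapse : ∀ a, collapseEven 𝕜 (Prod.snd : Fin n × Γ → Γ) (∑ sm ∈ T, M' a sm) =
      vertexOf 𝕜 degs (Ksp 0) + vertexOf 𝕜 degs (Ksp 1) := by
    intro a
    rw [hT, sum_product, Fin.sum_univ_two, map_add]
    have hs : ∀ s : Fin 2, collapseEven 𝕜 (Prod.snd : Fin n × Γ → Γ) (∑ m' ∈ degs, M' a (s, m')) = vertexOf 𝕜 degs (Ksp s) := by
      intro s
      exact collapseEven_replicaVertex 𝕜 degs (Ksp s) a
    rw [hs 0, hs 1]
  have hcum : ((cumulantOf (fun k => evenGaussConv 𝕜 C ((vertexOf 𝕜 degs (Ksp 0) + vertexOf 𝕜 degs (Ksp 1)) ^ k)) n :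
      evenPart 𝕜 Γ) : GrassmannAlgebra 𝕜 Γ) = ∑ η ∈ Fintype.piFinset (fun _ : Fin n => T),
        collapse 𝕜 (Prod.snd : Fin n × Γ → Γ) (U η : GrassmannAlgebra 𝕜 (Fin n × Γ)) := by
    have h1 := collapseEven_ursellOf_convMoment_eq_cumulantOf 𝕜 (Prod.snd : Fin n × Γ → Γ) C (fun a => ∑ sm ∈ T, M' a sm)
      (vertexOf 𝕜 degs (Ksp 0) + vertexOf 𝕜 degs (Ksp 1)) hcollapse huniv
    rw [card_univ, Fintype.card_fin] at h1
    rw [← h1, coe_collapseEven]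
    have h2 : ursellOf (convMoment 𝕜 C' (fun a => ∑ sm ∈ T, M' a sm)) univ = ∑ η ∈ Fintype.piFinset (fun _ : Fin n => T), U η :=
      ursellOf_convMoment_eq_sum_piFinset 𝕜 C' (Prod.fst : Fin n × Γ → Fin n) (fun _ : Fin n => T) M' hM'mem ⟨0, hn⟩
    rw [← hC', h2, AddSubmonoidClass.coe_finsetSum, map_sum]
  -- (2) the species-`0` family collapses to `X₀`, and expands over the degree assignments
  have hcum0 : ((cumulantOf (fun k => evenGaussConv 𝕜 C (vertexOf 𝕜 degs (Ksp 0) ^ k)) n : evenPart 𝕜 Γ) : GrassmannAlgebra 𝕜 Γ) =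
      ∑ δ ∈ Fintype.piFinset (fun _ : Fin n => degs),
        collapse 𝕜 (Prod.snd : Fin n × Γ → Γ) (U (fun a => ((0 : Fin 2), δ a)) : GrassmannAlgebra 𝕜 (Fin n × Γ)) := by
    have h1 := collapseEven_ursellOf_convMoment_eq_cumulantOf 𝕜 (Prod.snd : Fin n × Γ → Γ) C (replicaVertex 𝕜 degs (Ksp 0))
      (vertexOf 𝕜 degs (Ksp 0)) (collapseEven_replicaVertex 𝕜 degs (Ksp 0)) huniv
    rw [card_univ, Fintype.card_fin] at h1
    rw [← h1, coe_collapseEven]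
    have h2 : ursellOf (convMoment 𝕜 C' (replicaVertex 𝕜 degs (Ksp 0))) univ =
        ∑ δ ∈ Fintype.piFinset (fun _ : Fin n => degs), U (fun a => ((0 : Fin 2), δ a)) :=
      ursellOf_convMoment_eq_sum_piFinset 𝕜 C' (Prod.fst : Fin n × Γ → Fin n) (fun _ : Fin n => degs)
        (fun a m' => M' a (0, m')) (fun a m' => hM'mem a (0, m')) ⟨0, hn⟩
    rw [← hC', h2, AddSubmonoidClass.coe_finsetSum, map_sum]
  -- (3) the difference is the sum over the assignments with at least one species-`1` copy
  set emb : (Fin n → ℕ) ↪ (Fin n → Fin 2 × ℕ) :=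
    ⟨fun δ a => ((0 : Fin 2), δ a), fun _ _ h => funext fun a => congrArg Prod.snd (congrFun h a)⟩ with hemb
  have hfilter : (Fintype.piFinset (fun _ : Fin n => T)).filter (fun η => ∀ a, (η a).1 = 0) =
      (Fintype.piFinset (fun _ : Fin n => degs)).map emb := filter_piFinset_fst_eq_zero_eq_map degs
  have hdiff : ∀ W : Fin r → Γ,
      kernel 𝕜 ((cumulantOf (fun k => evenGaussConv 𝕜 C ((vertexOf 𝕜 degs (Ksp 0) + vertexOf 𝕜 degs (Ksp 1)) ^ k)) n :
          evenPart 𝕜 Γ) : GrassmannAlgebra 𝕜 Γ) r W -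
        kernel 𝕜 ((cumulantOf (fun k => evenGaussConv 𝕜 C (vertexOf 𝕜 degs (Ksp 0) ^ k)) n : evenPart 𝕜 Γ) : GrassmannAlgebra 𝕜 Γ) r W =
      ∑ η ∈ (Fintype.piFinset (fun _ : Fin n => T)).filter (fun η => ¬ ∀ a, (η a).1 = 0),
        kernel 𝕜 (collapse 𝕜 (Prod.snd : Fin n × Γ → Γ) (U η : GrassmannAlgebra 𝕜 (Fin n × Γ))) r W := by
    intro W
    rw [hcum, hcum0, kernel_sum, kernel_sum, ← sum_filter_add_sum_filter_not (Fintype.piFinset (fun _ : Fin n => T))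
      (fun η => ∀ a, (η a).1 = 0), hfilter, sum_map]
    simp only [hemb, Function.Embedding.coeFn_mk, add_sub_cancel_left]
  -- (4) the bound per assignment and pinned copy
  set g : Fin 2 × ℕ → ℝ := fun sm => (Real.exp 2 * (κ + ρ)) ^ (2 * sm.2) * Nsp sm.1 sm.2 with hg
  have hg0 : ∀ sm, 0 ≤ g sm := fun sm => mul_nonneg (by positivity) (hN0 _ _)
  set c : ℝ := ρ⁻¹ ^ r * κ⁻¹ ^ (2 * (n - 1)) * (((n - 1).factorial : ℝ) * α ^ (n - 1) * Real.exp n) with hc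
  have hc0 : 0 ≤ c := by positivity
  have hwt' : IsTreeWeight (fun S' : Finset (Fin n × Γ) => wt (S'.image Prod.snd)) := hwt.comap Prod.snd
  have hη : ∀ (η : Fin n → Fin 2 × ℕ), (¬ ∀ a, (η a).1 = 0) → ∀ (b : Fin n),
      ∑ W' ∈ univ.filter (fun W' : Fin r → Fin n × Γ => W' i = (b, w)),
      Λ * ‖kernel 𝕜 (U η : GrassmannAlgebra 𝕜 (Fin n × Γ)) r W'‖ ≤ c * ∏ a, g (η a) := by
    intro η hη1 b
    set δ : Fin n → ℕ := fun a => (η a).2 with hδ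
    -- admissibility of `Λ`: a species-`1` copy touches `Z`, the pinned output lies in the hull
    have hadm : ∀ (W' : Fin r → Fin n × Γ) (Ys : ∀ v : Fin n, Fin (2 * (η v).2) → Fin n × Γ), W' i = (b, w) →
        (∏ u, ‖replicaKer 𝕜 (Ksp (η u).1 (η u).2) u (Ys u)‖) ≠ 0 → univ.image W' ⊆ univ.image (flat Ys) →
        Λ ≤ wt ((univ.image (flat Ys)).image Prod.snd) := by
      intro W' Ys hW' hprod hsub
      obtain ⟨a, ha⟩ := not_forall.1 hη1
      have hKa : replicaKer 𝕜 (Ksp (η a).1 (η a).2) a (Ys a) ≠ 0 := fun h0 =>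
        hprod (prod_eq_zero (mem_univ a) (by rw [h0, norm_zero]))
      have hall : ∀ j, (Ys a j).1 = a := replicaKer_support 𝕜 (Ksp (η a).1 (η a).2) a (Ys a) hKa
      have hK1 : Ksp (η a).1 (η a).2 (fun j => (Ys a j).2) ≠ 0 := by
        intro h0; apply hKa; simp only [replicaKer, if_pos hall, h0]
      obtain ⟨j, hj⟩ := hZ (η a).1 ha (η a).2 _ hK1
      refine hΛ _ ?_ ⟨(Ys a j).2, ?_, hj⟩
      · exact mem_image.2 ⟨(b, w), hsub (mem_image.2 ⟨i, mem_univ _, hW'⟩), rfl⟩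
      · exact mem_image.2 ⟨Ys a j, mem_image.2 ⟨blockEmb _ a j, mem_univ _, flat_blockEmb _ Ys a j⟩, rfl⟩
    have hKs : ∀ (v : Fin n) (Yv : Fin (2 * (η v).2) → Fin n × Γ), replicaKer 𝕜 (Ksp (η v).1 (η v).2) v Yv ≠ 0 → ∀ j, (Yv j).1 = v :=
      fun v Yv h j => replicaKer_support 𝕜 (Ksp (η v).1 (η v).2) v Yv h j
    have hP : 0 ≤ ∏ a, g (η a) := prod_nonneg fun a _ => hg0 _
    by_cases hle : r + 2 * (n - 1) ≤ ∑ a, 2 * (η a).2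
    · have hcore := const_mul_sum_norm_kernel_ursellOf_kernelVertex_le_of_gramBounded C' (Prod.fst : Fin n × Γ → Fin n)
        (fun b => replicaKer 𝕜 (Ksp (η b).1 (η b).2) b) hwt' hκ.le hGB'
        (fun b => even_two_mul (η b).2) hKs (fun u => Nsp (η u).1 (η u).2) (fun u => hN0 _ _)
        (fun u j a' => sum_filter_wt_norm_replicaKer_le hwt (Ksp (η u).1 (η u).2) u (hN (η u).1 (η u).2) j a') hα.le
        (fun ℓ X' => sum_wt_norm_typeRestrict_submatrix_le C hα.le hrow ℓ X') (fun ℓ Y' => sum_wt_norm_typeRestrict_submatrix_le' C hα.le hcol ℓ Y')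
        (lam := (α * ((∑ a, (2 * δ a : ℝ)) + n))⁻¹) (by positivity) i (b, w) hΛ0 hadm
      refine hcore.trans ?_
      have hsumδ : (∑ v, 2 * (η v).2) = ∑ a, 2 * δ a := rfl
      have hA := choose_mul_pow_le (N := ∑ a, 2 * δ a) (r := r) (m := 2 * (n - 1)) hle hκ hρ
      have hTr := treeFactor_choice_le hn δ hα
      have hNprod : 0 ≤ ∏ u, Nsp (η u).1 (η u).2 := prod_nonneg fun u _ => hN0 _ _
      have hTnonneg : 0 ≤ ((α * ((∑ a, (2 * δ a : ℝ)) + n))⁻¹)⁻¹ ^ (n - 1) *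
          ∏ ℓ : Sym2 (Fin n), (1 + (α * ((∑ a, (2 * δ a : ℝ)) + n))⁻¹ * (α * (pairDeg (fun a => 2 * δ a) ℓ : ℝ))) := by
        have hs : 0 ≤ ∑ a, (2 * δ a : ℝ) := sum_nonneg fun a _ => by positivity
        exact mul_nonneg (by positivity) (prod_nonneg fun ℓ _ => by positivity)
      have hpd : (pairDeg (fun b : Fin n => 2 * (η b).2)) = pairDeg (fun a => 2 * δ a) := rfl
      rw [hsumδ, hpd]
      calc ((((r.factorial : ℝ))⁻¹ * ((∑ a, 2 * δ a).descFactorial r : ℝ)) * κ ^ ((∑ a, 2 * δ a) - (r + 2 * (n - 1))) *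
              ∏ u, Nsp (η u).1 (η u).2) *
            (((α * ((∑ a, (2 * δ a : ℝ)) + n))⁻¹)⁻¹ ^ (n - 1) *
              ∏ ℓ : Sym2 (Fin n), (1 + (α * ((∑ a, (2 * δ a : ℝ)) + n))⁻¹ * (α * (pairDeg (fun a => 2 * δ a) ℓ : ℝ))))
          ≤ ((ρ⁻¹ ^ r * κ⁻¹ ^ (2 * (n - 1)) * (κ + ρ) ^ (∑ a, 2 * δ a)) * ∏ u, Nsp (η u).1 (η u).2) *
              (((n - 1).factorial : ℝ) * α ^ (n - 1) * Real.exp (2 * (∑ a, (2 * δ a : ℝ)) + n)) :=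
            mul_le_mul (mul_le_mul_of_nonneg_right hA hNprod) hTr hTnonneg (by positivity)
        _ = c * ∏ a, g (η a) := by
            have hexp : Real.exp (2 * (∑ a, (2 * δ a : ℝ)) + n) = Real.exp n * ∏ a, Real.exp 2 ^ (2 * δ a) := by
              rw [Real.exp_add, mul_comm, mul_sum, Real.exp_sum]
              congr 1
              refine prod_congr rfl fun a _ => ?_
              rw [← Real.exp_nat_mul]
              congr 1
              push_cast
              ring
            rw [hexp, ← prod_pow_eq_pow_sum, hc]
            simp only [hg, hδ, mul_pow, prod_mul_distrib]
            ring
    · refine le_trans (le_of_eq (sum_eq_zero fun W' _ => ?_)) (mul_nonneg hc0 hP)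
      rw [hU]
      dsimp only
      rw [kernel_ursellOf_kernelVertex_eq_zero_of_lt_of_gramBounded C' (Prod.fst : Fin n × Γ → Fin n)
        (fun b => replicaKer 𝕜 (Ksp (η b).1 (η b).2) b) hκ.le hGB'
        (fun b => even_two_mul (η b).2) hKs ⟨0, hn⟩ (not_le.1 hle) W', norm_zero, mul_zero]
  -- (5) the sum of the weights over the assignments with a species-`1` copy
  have hgsum : ∑ η ∈ (Fintype.piFinset (fun _ : Fin n => T)).filter (fun η => ¬ ∀ a, (η a).1 = 0), ∏ a, g (η a) =
      (∑ m' ∈ degs, (Real.exp 2 * (κ + ρ)) ^ (2 * m') * Nsp 0 m' + ∑ m' ∈ degs, (Real.exp 2 * (κ + ρ)) ^ (2 * m') * Nsp 1 m') ^ n -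
        (∑ m' ∈ degs, (Real.exp 2 * (κ + ρ)) ^ (2 * m') * Nsp 0 m') ^ n := by
    have hall : ∑ η ∈ Fintype.piFinset (fun _ : Fin n => T), ∏ a, g (η a) =
        (∑ m' ∈ degs, (Real.exp 2 * (κ + ρ)) ^ (2 * m') * Nsp 0 m' + ∑ m' ∈ degs, (Real.exp 2 * (κ + ρ)) ^ (2 * m') * Nsp 1 m') ^ n := by
      rw [← prod_univ_sum (fun _ : Fin n => T) fun _ sm => g sm, prod_const, card_univ, Fintype.card_fin, hT, sum_product,
        Fin.sum_univ_two]
    have hzero : ∑ η ∈ (Fintype.piFinset (fun _ : Fin n => T)).filter (fun η => ∀ a, (η a).1 = 0), ∏ a, g (η a) =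
        (∑ m' ∈ degs, (Real.exp 2 * (κ + ρ)) ^ (2 * m') * Nsp 0 m') ^ n := by
      rw [hfilter, sum_map, ← sum_piFinset_prod_eq_pow degs fun m' => (Real.exp 2 * (κ + ρ)) ^ (2 * m') * Nsp 0 m']
      simp only [hemb, Function.Embedding.coeFn_mk, hg]
    rw [← sum_filter_add_sum_filter_not (Fintype.piFinset (fun _ : Fin n => T)) (fun η => ∀ a, (η a).1 = 0), hzero] at hall
    linarith
  -- (6) assemble
  set filt := (Fintype.piFinset (fun _ : Fin n => T)).filter (fun η => ¬ ∀ a, (η a).1 = 0) with hfilt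
  have hcoll : ∀ η ∈ filt, Λ * ∑ W ∈ univ.filter (fun W : Fin r → Γ => W i = w),
      ‖kernel 𝕜 (collapse 𝕜 (Prod.snd : Fin n × Γ → Γ) (U η : GrassmannAlgebra 𝕜 (Fin n × Γ))) r W‖ ≤ ∑ _b : Fin n, c * ∏ a, g (η a) := by
    intro η hη'
    have hη1 : ¬ ∀ a, (η a).1 = 0 := (mem_filter.1 hη').2
    calc Λ * ∑ W ∈ univ.filter (fun W : Fin r → Γ => W i = w),
          ‖kernel 𝕜 (collapse 𝕜 (Prod.snd : Fin n × Γ → Γ) (U η : GrassmannAlgebra 𝕜 (Fin n × Γ))) r W‖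
        ≤ Λ * ∑ b : Fin n, ∑ W' ∈ univ.filter (fun W' : Fin r → Fin n × Γ => W' i = (b, w)),
            ‖kernel 𝕜 (U η : GrassmannAlgebra 𝕜 (Fin n × Γ)) r W'‖ :=
          mul_le_mul_of_nonneg_left (sum_filter_norm_kernel_collapse_le _ i w) hΛ0
      _ = ∑ b : Fin n, ∑ W' ∈ univ.filter (fun W' : Fin r → Fin n × Γ => W' i = (b, w)),
            Λ * ‖kernel 𝕜 (U η : GrassmannAlgebra 𝕜 (Fin n × Γ)) r W'‖ := by
          rw [mul_sum]
          exact sum_congr rfl fun b _ => mul_sum _ _ _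
      _ ≤ ∑ _b : Fin n, c * ∏ a, g (η a) := sum_le_sum fun b _ => hη η hη1 b
  calc Λ * ∑ W ∈ univ.filter (fun W : Fin r → Γ => W i = w),
        ‖kernel 𝕜 ((cumulantOf (fun k => evenGaussConv 𝕜 C ((vertexOf 𝕜 degs (Ksp 0) + vertexOf 𝕜 degs (Ksp 1)) ^ k)) n :
            evenPart 𝕜 Γ) : GrassmannAlgebra 𝕜 Γ) r W -
          kernel 𝕜 ((cumulantOf (fun k => evenGaussConv 𝕜 C (vertexOf 𝕜 degs (Ksp 0) ^ k)) n : evenPart 𝕜 Γ) :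
            GrassmannAlgebra 𝕜 Γ) r W‖
      = Λ * ∑ W ∈ univ.filter (fun W : Fin r → Γ => W i = w),
          ‖∑ η ∈ filt, kernel 𝕜 (collapse 𝕜 (Prod.snd : Fin n × Γ → Γ) (U η : GrassmannAlgebra 𝕜 (Fin n × Γ))) r W‖ := by
        congr 1
        exact sum_congr rfl fun W _ => by rw [hdiff W]
    _ ≤ Λ * ∑ W ∈ univ.filter (fun W : Fin r → Γ => W i = w),
          ∑ η ∈ filt, ‖kernel 𝕜 (collapse 𝕜 (Prod.snd : Fin n × Γ → Γ) (U η : GrassmannAlgebra 𝕜 (Fin n × Γ))) r W‖ :=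
        mul_le_mul_of_nonneg_left (sum_le_sum fun W _ => norm_sum_le _ _) hΛ0
    _ = ∑ η ∈ filt, Λ * ∑ W ∈ univ.filter (fun W : Fin r → Γ => W i = w),
            ‖kernel 𝕜 (collapse 𝕜 (Prod.snd : Fin n × Γ → Γ) (U η : GrassmannAlgebra 𝕜 (Fin n × Γ))) r W‖ := by
        rw [sum_comm, mul_sum]
    _ ≤ ∑ η ∈ filt, ∑ _b : Fin n, c * ∏ a, g (η a) := sum_le_sum fun η hη' => hcoll η hη'
    _ = (n : ℝ) * c * ∑ η ∈ filt, ∏ a, g (η a) := by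
        rw [mul_sum]
        exact sum_congr rfl fun η _ => by rw [sum_const, card_univ, Fintype.card_fin, nsmul_eq_mul]; ring
    _ = (n.factorial : ℝ) * (ρ⁻¹ ^ r * κ⁻¹ ^ (2 * (n - 1)) * (α ^ (n - 1) * Real.exp n)) *
        ((∑ m' ∈ degs, (Real.exp 2 * (κ + ρ)) ^ (2 * m') * Nsp 0 m' + ∑ m' ∈ degs, (Real.exp 2 * (κ + ρ)) ^ (2 * m') * Nsp 1 m') ^ n -
          (∑ m' ∈ degs, (Real.exp 2 * (κ + ρ)) ^ (2 * m') * Nsp 0 m') ^ n) := by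
        rw [hfilt, hgsum, hc, ← Nat.mul_factorial_pred (Nat.pos_iff_ne_zero.1 hn), Nat.cast_mul]
        ring

end Polarised

/-! ### The inhomogeneous Lipschitz bound for the effective action -/

section Lipschitz

/-- A `wt`-weighted anchored profile bound implies the unweighted one (`1 ≤ wt`). [folklore] -/
private theorem sum_filter_norm_le_of_wt (hwt : IsTreeWeight wt) {m : ℕ} (K : (Fin m → Γ) → 𝕜) {N : ℝ} (j : Fin m) (w : Γ)
    (hN : ∑ Y ∈ univ.filter (fun Y : Fin m → Γ => Y j = w), ‖K Y‖ * wt (univ.image Y) ≤ N) :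
    ∑ Y ∈ univ.filter (fun Y : Fin m → Γ => Y j = w), ‖K Y‖ ≤ N :=
  (sum_le_sum fun _ _ => le_mul_of_one_le_right (norm_nonneg _) (hwt.one_le _)).trans hN

omit [Fintype Γ] in
/-- A `wt`-weighted row-sum bound implies the unweighted one (`1 ≤ wt`). [folklore] -/
private theorem sum_norm_le_of_wt (hwt : IsTreeWeight wt) (s : Finset Γ) (f : Γ → 𝕜) (p : Γ → Finset Γ) {α : ℝ}
    (h : ∑ Y ∈ s, ‖f Y‖ * wt (p Y) ≤ α) : ∑ Y ∈ s, ‖f Y‖ ≤ α :=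
  (sum_le_sum fun _ _ => le_mul_of_one_le_right (norm_nonneg _) (hwt.one_le _)).trans h

/-- **THE EFFECTIVE ACTION IS LIPSCHITZ IN THE INTERACTION, INHOMOGENEOUSLY: a defect touching a zone is invisible at deep pins up to `Λ⁻¹`**
(BGM 2006 (2.13)–(2.14), (2.77)–(2.80), (2.86)–(2.90) with tree-weighted norms; the zone form of `sum_norm_kernel_effAction_add_sub_le_of_gramBounded`):
charged covariance replica-Gram-bounded with constant `κ`, `wt`-weighted row/column sums `≤ α`, output weight `ρ`, two even interactions `V₁, V₂` without
constant part with `wt`-weighted pinned profiles `N₁, N₂`, `θ = eα(‖V₁‖_{h,wt} + ‖V₂‖_{h,wt})/κ² < 1`, every kernel of `V₂` supported on label families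
touching `Z`, and `Λ ≤ wt S` for all label sets `S ∋ w` meeting `Z`; then in every degree `m ≥ 1`, the output slot `i` pinned at `w`,
`Λ · Σ_{W : W_i = w} ‖kernel_m (effAction C (V₁ + V₂)) (W) − kernel_m (effAction C V₁) (W)‖ ≤ ρ^{-m} · e‖V₂‖_{h,wt} / (1 − θ)²`.
With `wt = 1 + diam` and `dist(w, Z) ≥ R`: `Λ = 1 + R`. [cite: BenfattoGiulianiMastropietro2006, (2.13)-(2.14) and (2.86)-(2.90)] -/
theorem const_mul_sum_norm_kernel_effAction_add_sub_le_of_gramBounded (hwt : IsTreeWeight wt) {κ : ℝ} (hκ : 0 < κ) (hGB : IsGramBoundedR C κ)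
    (V₁ V₂ : GrassmannAlgebra 𝕜 Γ) (hV₁ : V₁ ∈ evenPart 𝕜 Γ) (hV₂ : V₂ ∈ evenPart 𝕜 Γ)
    (hV₁0 : constPart 𝕜 V₁ = 0) (hV₂0 : constPart 𝕜 V₂ = 0) (N₁ N₂ : ℕ → ℝ) (hN₁0 : ∀ m', 0 ≤ N₁ m') (hN₂0 : ∀ m', 0 ≤ N₂ m')
    (hN₁ : ∀ m' (j : Fin (2 * m')) (w : Γ), ∑ Y ∈ univ.filter (fun Y : Fin (2 * m') → Γ => Y j = w),
      ‖kernel 𝕜 V₁ (2 * m') Y‖ * wt (univ.image Y) ≤ N₁ m')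
    (hN₂ : ∀ m' (j : Fin (2 * m')) (w : Γ), ∑ Y ∈ univ.filter (fun Y : Fin (2 * m') → Γ => Y j = w),
      ‖kernel 𝕜 V₂ (2 * m') Y‖ * wt (univ.image Y) ≤ N₂ m')
    {α : ℝ} (hα : 0 < α) (hrow : ∀ X, ∑ Y, ‖C X Y‖ * wt {X, Y} ≤ α) (hcol : ∀ Y, ∑ X, ‖C X Y‖ * wt {X, Y} ≤ α) {ρ : ℝ} (hρ : 0 < ρ)
    (hθ : Real.exp 1 * α * (normV Γ κ ρ N₁ + normV Γ κ ρ N₂) / κ ^ 2 < 1)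
    (Z : Set Γ) (hZ : ∀ (m' : ℕ) (Y : Fin (2 * m') → Γ), kernel 𝕜 V₂ (2 * m') Y ≠ 0 → ∃ j, Y j ∈ Z)
    (w : Γ) {Λ : ℝ} (hΛ0 : 0 ≤ Λ) (hΛ : ∀ S : Finset Γ, w ∈ S → (∃ z ∈ S, z ∈ Z) → Λ ≤ wt S)
    {m : ℕ} (hm : 0 < m) (i : Fin m) :
    Λ * ∑ W ∈ univ.filter (fun W : Fin m → Γ => W i = w),
        ‖kernel 𝕜 (effAction 𝕜 C (V₁ + V₂)) m W - kernel 𝕜 (effAction 𝕜 C V₁) m W‖ ≤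
      ρ⁻¹ ^ m * (Real.exp 1 * normV Γ κ ρ N₂) / (1 - Real.exp 1 * α * (normV Γ κ ρ N₁ + normV Γ κ ρ N₂) / κ ^ 2) ^ 2 := by
  -- notation
  set degs : Finset ℕ := range (Fintype.card Γ / 2 + 1) with hdegs
  set a : ℝ := normV Γ κ ρ N₁ with ha
  set b : ℝ := normV Γ κ ρ N₂ with hb
  set θ : ℝ := Real.exp 1 * α * (a + b) / κ ^ 2 with hθdef
  have ha0 : 0 ≤ a := normV_nonneg hκ.le hρ.le hN₁0
  have hb0 : 0 ≤ b := normV_nonneg hκ.le hρ.le hN₂0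
  have hθ0 : 0 ≤ θ := by positivity
  have hθ1 : θ < 1 := hθ
  have hexpn : ∀ k : ℕ, Real.exp k = Real.exp 1 ^ k := fun k => by rw [← Real.exp_nat_mul, mul_one]
  -- unweighted data
  have hN₁u : ∀ m' (j : Fin (2 * m')) (w : Γ), ∑ Y ∈ univ.filter (fun Y : Fin (2 * m') → Γ => Y j = w), ‖kernel 𝕜 V₁ (2 * m') Y‖ ≤ N₁ m' :=
    fun m' j w => sum_filter_norm_le_of_wt hwt _ j w (hN₁ m' j w)
  have hN₂u : ∀ m' (j : Fin (2 * m')) (w : Γ), ∑ Y ∈ univ.filter (fun Y : Fin (2 * m') → Γ => Y j = w), ‖kernel 𝕜 V₂ (2 * m') Y‖ ≤ N₂ m' :=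
    fun m' j w => sum_filter_norm_le_of_wt hwt _ j w (hN₂ m' j w)
  have hrowu : ∀ X, ∑ Y, ‖C X Y‖ ≤ α := fun X => sum_norm_le_of_wt hwt univ (fun Y => C X Y) (fun Y => {X, Y}) (hrow X)
  have hcolu : ∀ Y, ∑ X, ‖C X Y‖ ≤ α := fun Y => sum_norm_le_of_wt hwt univ (fun X => C X Y) (fun X => {X, Y}) (hcol Y)
  -- the profile of the sum
  have hV₁₂ : V₁ + V₂ ∈ evenPart 𝕜 Γ := add_mem hV₁ hV₂
  have hV₁₂0 : constPart 𝕜 (V₁ + V₂) = 0 := by rw [map_add, hV₁0, hV₂0, add_zero]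
  have hN₁₂ : ∀ m' (j : Fin (2 * m')) (w : Γ), ∑ Y ∈ univ.filter (fun Y : Fin (2 * m') → Γ => Y j = w),
      ‖kernel 𝕜 (V₁ + V₂) (2 * m') Y‖ ≤ (fun m' => N₁ m' + N₂ m') m' := by
    intro m' j w
    calc ∑ Y ∈ univ.filter (fun Y : Fin (2 * m') → Γ => Y j = w), ‖kernel 𝕜 (V₁ + V₂) (2 * m') Y‖
        ≤ ∑ Y ∈ univ.filter (fun Y : Fin (2 * m') → Γ => Y j = w), (‖kernel 𝕜 V₁ (2 * m') Y‖ + ‖kernel 𝕜 V₂ (2 * m') Y‖) :=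
          sum_le_sum fun Y _ => by rw [kernel_add]; exact norm_add_le _ _
      _ ≤ N₁ m' + N₂ m' := by rw [sum_add_distrib]; exact add_le_add (hN₁u m' j w) (hN₂u m' j w)
  have hnV₁₂ : normV Γ κ ρ (fun m' => N₁ m' + N₂ m') = a + b := by
    rw [ha, hb, normV, normV, normV, ← sum_add_distrib]
    exact sum_congr rfl fun m' _ => by ring
  have hθ₁ : Real.exp 1 * α * normV Γ κ ρ N₁ / κ ^ 2 < 1 := by
    refine lt_of_le_of_lt ?_ hθ
    exact div_le_div_of_nonneg_right (mul_le_mul_of_nonneg_left (le_add_of_nonneg_right hb0) (by positivity)) (by positivity)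
  have hθ₁₂ : Real.exp 1 * α * normV Γ κ ρ (fun m' => N₁ m' + N₂ m') / κ ^ 2 < 1 := by rw [hnV₁₂]; exact hθ
  -- the two truncation theorems (the tails of the cumulant series)
  have hT₁ := fun n₀ (hn₀ : 0 < n₀) => sum_norm_kernel_effAction_add_sum_cumulant_le_of_gramBounded C hκ hGB V₁ hV₁ hV₁0 N₁ hN₁0 hN₁u hα
    hrowu hcolu hρ hθ₁ hn₀
  have hT₁₂ := fun n₀ (hn₀ : 0 < n₀) => sum_norm_kernel_effAction_add_sum_cumulant_le_of_gramBounded C hκ hGB (V₁ + V₂) hV₁₂ hV₁₂0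
    (fun m' => N₁ m' + N₂ m') (fun m' => add_nonneg (hN₁0 m') (hN₂0 m')) hN₁₂ hα hrowu hcolu hρ hθ₁₂ hn₀
  -- the kernels of `-V₁`, `-V₂` as `vertexOf`
  set X₁ : evenPart 𝕜 Γ := ⟨-V₁, neg_mem hV₁⟩ with hX₁
  set X₂ : evenPart 𝕜 Γ := ⟨-V₂, neg_mem hV₂⟩ with hX₂
  set X₁₂ : evenPart 𝕜 Γ := ⟨-(V₁ + V₂), neg_mem hV₁₂⟩ with hX₁₂
  set Ksp : Fin 2 → (m' : ℕ) → (Fin (2 * m') → Γ) → 𝕜 := fun s m' =>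
    if s = 0 then kernel 𝕜 (-V₁) (2 * m') else kernel 𝕜 (-V₂) (2 * m') with hKsp
  have hXv₁ : vertexOf 𝕜 degs (Ksp 0) = X₁ := Subtype.ext (coe_vertexOf_kernel_eq 𝕜 X₁)
  have hXv₂ : vertexOf 𝕜 degs (Ksp 1) = X₂ := Subtype.ext (coe_vertexOf_kernel_eq 𝕜 X₂)
  have hX₁₂eq : X₁ + X₂ = X₁₂ := Subtype.ext (by change -V₁ + -V₂ = -(V₁ + V₂); rw [neg_add])
  set Nsp : Fin 2 → ℕ → ℝ := fun s => if s = 0 then N₁ else N₂ with hNsp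
  have hNsp0 : ∀ s m', 0 ≤ Nsp s m' := by
    intro s m'; simp only [hNsp]; split_ifs; exacts [hN₁0 m', hN₂0 m']
  have hKneg : ∀ (V : GrassmannAlgebra 𝕜 Γ) (m' : ℕ) (Y : Fin (2 * m') → Γ), kernel 𝕜 (-V) (2 * m') Y = -kernel 𝕜 V (2 * m') Y := by
    intro V m' Y
    rw [show -V = (-1 : 𝕜) • V from (neg_one_smul 𝕜 V).symm, kernel_smul, neg_one_mul]
  have hKnorm : ∀ (V : GrassmannAlgebra 𝕜 Γ) (m' : ℕ) (Y : Fin (2 * m') → Γ), ‖kernel 𝕜 (-V) (2 * m') Y‖ = ‖kernel 𝕜 V (2 * m') Y‖ := by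
    intro V m' Y; rw [hKneg, norm_neg]
  have hNspB : ∀ s m' (j : Fin (2 * m')) (w : Γ), ∑ Y ∈ univ.filter (fun Y : Fin (2 * m') → Γ => Y j = w),
      ‖Ksp s m' Y‖ * wt (univ.image Y) ≤ Nsp s m' := by
    intro s m' j w
    simp only [hKsp, hNsp]
    split_ifs
    · simp only [hKnorm]; exact hN₁ m' j w
    · simp only [hKnorm]; exact hN₂ m' j w
  have hZsp : ∀ (s : Fin 2), s ≠ 0 → ∀ (m' : ℕ) (Y : Fin (2 * m') → Γ), Ksp s m' Y ≠ 0 → ∃ j, Y j ∈ Z := by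
    intro s hs m' Y hY
    simp only [hKsp, if_neg hs] at hY
    rw [hKneg, neg_ne_zero] at hY
    exact hZ m' Y hY
  have hA₀ : ∑ m' ∈ degs, (Real.exp 2 * (κ + ρ)) ^ (2 * m') * Nsp 0 m' = a := by simp only [hNsp, if_pos rfl]; rfl
  have hA₁ : ∑ m' ∈ degs, (Real.exp 2 * (κ + ρ)) ^ (2 * m') * Nsp 1 m' = b := by
    simp only [hNsp, if_neg (show (1 : Fin 2) ≠ 0 by decide)]; rfl
  -- the cumulants
  set κ₁ : ℕ → evenPart 𝕜 Γ := fun n => cumulantOf (fun k => evenGaussConv 𝕜 C (X₁ ^ k)) n with hκ₁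
  set κ₁₂ : ℕ → evenPart 𝕜 Γ := fun n => cumulantOf (fun k => evenGaussConv 𝕜 C (X₁₂ ^ k)) n with hκ₁₂
  -- the zone-polarised bound per order
  have hbd : ∀ {n : ℕ}, 0 < n → Λ * ∑ W ∈ univ.filter (fun W : Fin m → Γ => W i = w),
      ‖kernel 𝕜 ((κ₁₂ n : evenPart 𝕜 Γ) : GrassmannAlgebra 𝕜 Γ) m W - kernel 𝕜 ((κ₁ n : evenPart 𝕜 Γ) : GrassmannAlgebra 𝕜 Γ) m W‖ ≤
        (n ! : ℝ) * (ρ⁻¹ ^ m * (Real.exp 1 * b) * ((n : ℝ) * θ ^ (n - 1))) := by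
    intro n hn
    have h := const_mul_sum_norm_kernel_cumulantOf_add_sub_le_of_gramBounded C hwt hκ hGB degs Ksp Nsp hNsp0 hNspB hα hrow hcol hρ hn i w
      Z hZsp hΛ0 hΛ
    rw [hXv₁, hXv₂, hX₁₂eq, hA₀, hA₁] at h
    refine h.trans ?_
    have hpow := add_pow_sub_pow_le' ha0 hb0 n
    obtain ⟨n', rfl⟩ : ∃ n', n = n' + 1 := ⟨n - 1, by omega⟩
    rw [Nat.add_sub_cancel] at hpow h ⊢
    have hc0 : 0 ≤ (((n' + 1).factorial : ℝ)) * (ρ⁻¹ ^ m * κ⁻¹ ^ (2 * n') * (α ^ n' * Real.exp (((n' + 1 : ℕ) : ℝ)))) := by positivity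
    refine (mul_le_mul_of_nonneg_left hpow hc0).trans (le_of_eq ?_)
    rw [hθdef, hexpn, div_pow, mul_pow, mul_pow, pow_succ (Real.exp 1) n']
    simp only [inv_pow]
    have hκ2 : κ ^ 2 ≠ 0 := by positivity
    have hκpow : κ ^ (2 * n') ≠ 0 := by positivity
    have hρpow : ρ ^ m ≠ 0 := by positivity
    field_simp
    ring
  -- for every truncation order: the two tails and the polarised partial sum
  have hmain : ∀ n₀ : ℕ, 0 < n₀ → Λ * ∑ W ∈ univ.filter (fun W : Fin m → Γ => W i = w),
      ‖kernel 𝕜 (effAction 𝕜 C (V₁ + V₂)) m W - kernel 𝕜 (effAction 𝕜 C V₁) m W‖ ≤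
        ρ⁻¹ ^ m * (Real.exp 1 * b) / (1 - θ) ^ 2 +
          Λ * (ρ⁻¹ ^ m * (Real.exp 1 * (a + b)) * θ ^ (n₀ - 1) / (1 - θ) + ρ⁻¹ ^ m * (Real.exp 1 * a) *
            (Real.exp 1 * α * a / κ ^ 2) ^ (n₀ - 1) / (1 - Real.exp 1 * α * a / κ ^ 2)) := by
    intro n₀ hn₀
    have h₁ := (hT₁ n₀ hn₀).2 hm i w
    have h₁₂ := (hT₁₂ n₀ hn₀).2 hm i w
    rw [hnV₁₂] at h₁₂
    -- the partial sums
    set S₁ : (Fin m → Γ) → 𝕜 := fun W => ∑ n ∈ Ico 1 n₀, ((n ! : 𝕜))⁻¹ *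
      kernel 𝕜 ((κ₁ n : evenPart 𝕜 Γ) : GrassmannAlgebra 𝕜 Γ) m W with hS₁
    set S₁₂ : (Fin m → Γ) → 𝕜 := fun W => ∑ n ∈ Ico 1 n₀, ((n ! : 𝕜))⁻¹ *
      kernel 𝕜 ((κ₁₂ n : evenPart 𝕜 Γ) : GrassmannAlgebra 𝕜 Γ) m W with hS₁₂
    have hsplitW : ∀ W, kernel 𝕜 (effAction 𝕜 C (V₁ + V₂)) m W - kernel 𝕜 (effAction 𝕜 C V₁) m W =
        (kernel 𝕜 (effAction 𝕜 C (V₁ + V₂)) m W + S₁₂ W) - (kernel 𝕜 (effAction 𝕜 C V₁) m W + S₁ W) - (S₁₂ W - S₁ W) := fun W => by ring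
    have hpartial : Λ * ∑ W ∈ univ.filter (fun W : Fin m → Γ => W i = w), ‖S₁₂ W - S₁ W‖ ≤ ρ⁻¹ ^ m * (Real.exp 1 * b) / (1 - θ) ^ 2 := by
      have hSdiff : ∀ W, S₁₂ W - S₁ W = ∑ n ∈ Ico 1 n₀, ((n ! : 𝕜))⁻¹ *
          (kernel 𝕜 ((κ₁₂ n : evenPart 𝕜 Γ) : GrassmannAlgebra 𝕜 Γ) m W - kernel 𝕜 ((κ₁ n : evenPart 𝕜 Γ) : GrassmannAlgebra 𝕜 Γ) m W) := by
        intro W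
        rw [hS₁₂, hS₁]
        dsimp only
        rw [← sum_sub_distrib]
        exact sum_congr rfl fun n _ => by ring
      calc Λ * ∑ W ∈ univ.filter (fun W : Fin m → Γ => W i = w), ‖S₁₂ W - S₁ W‖
          ≤ Λ * ∑ W ∈ univ.filter (fun W : Fin m → Γ => W i = w), ∑ n ∈ Ico 1 n₀, (n ! : ℝ)⁻¹ *
              ‖kernel 𝕜 ((κ₁₂ n : evenPart 𝕜 Γ) : GrassmannAlgebra 𝕜 Γ) m W - kernel 𝕜 ((κ₁ n : evenPart 𝕜 Γ) : GrassmannAlgebra 𝕜 Γ) m W‖ := by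
            refine mul_le_mul_of_nonneg_left (sum_le_sum fun W _ => ?_) hΛ0
            rw [hSdiff W]
            refine (norm_sum_le _ _).trans (le_of_eq (sum_congr rfl fun n _ => ?_))
            rw [norm_mul, norm_inv, RCLike.norm_natCast]
        _ = ∑ n ∈ Ico 1 n₀, (n ! : ℝ)⁻¹ * (Λ * ∑ W ∈ univ.filter (fun W : Fin m → Γ => W i = w),
              ‖kernel 𝕜 ((κ₁₂ n : evenPart 𝕜 Γ) : GrassmannAlgebra 𝕜 Γ) m W - kernel 𝕜 ((κ₁ n : evenPart 𝕜 Γ) : GrassmannAlgebra 𝕜 Γ) m W‖) := by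
            rw [sum_comm, mul_sum]; exact sum_congr rfl fun n _ => by rw [mul_sum, mul_sum, mul_sum]; exact sum_congr rfl fun W _ => by ring
        _ ≤ ∑ n ∈ Ico 1 n₀, (n ! : ℝ)⁻¹ * ((n ! : ℝ) * (ρ⁻¹ ^ m * (Real.exp 1 * b) * ((n : ℝ) * θ ^ (n - 1)))) :=
            sum_le_sum fun n hn => mul_le_mul_of_nonneg_left (hbd (mem_Ico.1 hn).1) (by positivity)
        _ = ρ⁻¹ ^ m * (Real.exp 1 * b) * ∑ n ∈ Ico 1 n₀, (n : ℝ) * θ ^ (n - 1) := by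
            rw [mul_sum]
            refine sum_congr rfl fun n _ => ?_
            have hfact : (n ! : ℝ) ≠ 0 := by positivity
            field_simp
        _ ≤ ρ⁻¹ ^ m * (Real.exp 1 * b) * (1 / (1 - θ) ^ 2) := by
            refine mul_le_mul_of_nonneg_left ?_ (by positivity)
            have hshift : ∑ n ∈ Ico 1 n₀, (n : ℝ) * θ ^ (n - 1) = ∑ k ∈ range (n₀ - 1), ((k : ℝ) + 1) * θ ^ k := by
              rcases n₀ with _ | n₀
              · simp
              · rw [Nat.add_sub_cancel, sum_Ico_eq_sum_range]
                refine sum_congr (by simp) fun k _ => ?_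
                push_cast
                rw [show 1 + k - 1 = k by omega]
                ring
            rw [hshift]
            exact sum_range_succ_mul_pow_le' hθ0 hθ1 _
        _ = ρ⁻¹ ^ m * (Real.exp 1 * b) / (1 - θ) ^ 2 := by ring
    calc Λ * ∑ W ∈ univ.filter (fun W : Fin m → Γ => W i = w), ‖kernel 𝕜 (effAction 𝕜 C (V₁ + V₂)) m W - kernel 𝕜 (effAction 𝕜 C V₁) m W‖
        ≤ Λ * ∑ W ∈ univ.filter (fun W : Fin m → Γ => W i = w),
            (‖S₁₂ W - S₁ W‖ + (‖kernel 𝕜 (effAction 𝕜 C (V₁ + V₂)) m W + S₁₂ W‖ + ‖kernel 𝕜 (effAction 𝕜 C V₁) m W + S₁ W‖)) := by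
          refine mul_le_mul_of_nonneg_left (sum_le_sum fun W _ => ?_) hΛ0
          rw [hsplitW W]
          refine (norm_sub_le _ _).trans ?_
          have h := norm_sub_le (kernel 𝕜 (effAction 𝕜 C (V₁ + V₂)) m W + S₁₂ W) (kernel 𝕜 (effAction 𝕜 C V₁) m W + S₁ W)
          linarith
      _ = Λ * ∑ W ∈ univ.filter (fun W : Fin m → Γ => W i = w), ‖S₁₂ W - S₁ W‖ +
            Λ * (∑ W ∈ univ.filter (fun W : Fin m → Γ => W i = w), ‖kernel 𝕜 (effAction 𝕜 C (V₁ + V₂)) m W + S₁₂ W‖ +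
              ∑ W ∈ univ.filter (fun W : Fin m → Γ => W i = w), ‖kernel 𝕜 (effAction 𝕜 C V₁) m W + S₁ W‖) := by
          rw [sum_add_distrib, sum_add_distrib, mul_add]
      _ ≤ ρ⁻¹ ^ m * (Real.exp 1 * b) / (1 - θ) ^ 2 +
            Λ * (ρ⁻¹ ^ m * (Real.exp 1 * (a + b)) * θ ^ (n₀ - 1) / (1 - θ) + ρ⁻¹ ^ m * (Real.exp 1 * a) *
              (Real.exp 1 * α * a / κ ^ 2) ^ (n₀ - 1) / (1 - Real.exp 1 * α * a / κ ^ 2)) :=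
          add_le_add hpartial (mul_le_mul_of_nonneg_left (add_le_add h₁₂ h₁) hΛ0)
  -- let the truncation order tend to infinity
  have hθa0 : 0 ≤ Real.exp 1 * α * a / κ ^ 2 := by positivity
  have hθa1 : Real.exp 1 * α * a / κ ^ 2 < 1 := hθ₁
  have htail : Filter.Tendsto (fun n₀ : ℕ => Λ * (ρ⁻¹ ^ m * (Real.exp 1 * (a + b)) * θ ^ (n₀ - 1) / (1 - θ) +
      ρ⁻¹ ^ m * (Real.exp 1 * a) * (Real.exp 1 * α * a / κ ^ 2) ^ (n₀ - 1) / (1 - Real.exp 1 * α * a / κ ^ 2)))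
      Filter.atTop (nhds 0) := by
    have hsub : Filter.Tendsto (fun n₀ : ℕ => n₀ - 1) Filter.atTop Filter.atTop := Filter.tendsto_sub_atTop_nat 1
    have h1 : Filter.Tendsto (fun n₀ : ℕ => θ ^ (n₀ - 1)) Filter.atTop (nhds 0) :=
      (tendsto_pow_atTop_nhds_zero_of_lt_one hθ0 hθ1).comp hsub
    have h2 : Filter.Tendsto (fun n₀ : ℕ => (Real.exp 1 * α * a / κ ^ 2) ^ (n₀ - 1)) Filter.atTop (nhds 0) :=
      (tendsto_pow_atTop_nhds_zero_of_lt_one hθa0 hθa1).comp hsub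
    have h1' := ((h1.const_mul (ρ⁻¹ ^ m * (Real.exp 1 * (a + b)))).div_const (1 - θ))
    have h2' := ((h2.const_mul (ρ⁻¹ ^ m * (Real.exp 1 * a))).div_const (1 - Real.exp 1 * α * a / κ ^ 2))
    simpa using (h1'.add h2').const_mul Λ
  have hlim := htail.const_add (ρ⁻¹ ^ m * (Real.exp 1 * b) / (1 - θ) ^ 2)
  rw [add_zero] at hlim
  exact ge_of_tendsto hlim (Filter.eventually_atTop.2 ⟨1, fun n₀ hn₀ => hmain n₀ hn₀⟩)

end Lipschitz


end Literature.MathematicalPhysics.QuantumLattice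

end
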